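import Summits.QuantumFields.YangMills.Theorems.BalabanUVNodesPortS1ClassTwins
import Summits.QuantumFields.YangMills.Theorems.BalabanUVNodesPortS1JacKStepGlue
import Summits.QuantumFields.YangMills.Theorems.BalabanUVNodesPortS1ResidueWAdd
import Summits.QuantumFields.YangMills.Theorems.BalabanUVNodesPortRecordRepresentationS1StubLZjacKStep
import Summits.QuantumFields.YangMills.Theorems.BalabanUVNodesPortRecordRepresentationS1StubLZjacDom

/-!
# NODE O port PT-A — THE δ-JACOBIAN HALF OF `log Z^{(k)}` ON PRINT's ε₀-CLASS IS A THEOREM (★★★ director-ym №627a (1′), g11 docket 1, part B): `phiLZjac` is represented in Thm 3's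
# format AT EVERY POINT of `InRegClass … δ₀ …` for ONE explicit class radius `δ₀ = min (ε₁∕2) (1∕(53581824·L⁶))`, unconditionally (rows (a)(b) from the landed stubs ✓`stub_LZjacDom`, ✓`stub_LZjacKStep`)

Cell `ym-nodeO-ideate`, porter seat PT-A-1 (gen 11); `--kind proof --supports stmt-QuantumFields-27930 --as helper`; count-neutral.  [I] = [Balaban1987RG1]; [15] = [Balaban1985Variational].

WHY.  `stub_LZhalfReg : ∀ F, PortRecordLZHalfReg F` (v3.7) is the LZ half with the (f′) row ON the class `InRegClass … δ₀` (✓`…FEStepReg`); `phiLZ = phiLZjac + phiLZdet` (✓`…HalvesJacDefs`).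
This file settles the `phiLZjac` summand outright: ✓`…ClassTwins` supplies every B-dependent input at class points (no analyticity token), the rows (a)–(e) are B-free and landed.  The Gaussian
summand `phiLZdet` follows in part C modulo `ClassP2Reg` + the located class letter (P5)+NEST (this seat's nodeO line of this hour).
* §1 ε₀-class editions of the bookkeeping of ✓`…ResidueWAdd` ∕ ✓`…HalvesGlue` ∕ ✓`…SplitGerm`: `representsOnRegW_add`, `residueOnRegAtW_add`, `representsOnRegW_congr`, `residueOnRegAtW_anti_radii`,
  `residueOnRegAtW_mono`, `residueOnRegAtW_anti_eps` (a smaller class radius keeps the residue).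
* §2 ★★★ `representsOnRegW_phiLZjac` — (f′)-Reg for the δ-Jacobian bracket: `phiLZjac n B = Σ_X (X ∈ wrap ? E_T(X, pair cut to X) : Ψ_jac(X̂)(pulled-back cut pair))` AT EVERY class point
  (the germ proof of ✓`representsW_phiLZjac` with ✓`jacFactor_eq_jacTorus_of_inRegClass` for the germ lemma and ✓`inRegClass_zero` for the base point).
* §3 ★★★ `lzjacResidueOnReg` — for EVERY torus family, under `McGuard`, `2L² ≤ B₃`, `0 < a₀`, `0 < a₁` and ⁸'s TokE token: for every `ε₂₉`, k-UNIFORM `E₁ κ α₀ α₁ δ₀` (`δ₀ > 0` the class radius)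
  with, at every `k`, `Ψ_jac.ResidueOnRegAtW … δ₀ E₁ κ (phiLZjac …)` — UNCONDITIONAL (`JacRowsAB F` from ✓`jacRowsAB_all_of_kstep_of_dom stub_LZjacKStep stub_LZjacDom`).

HONEST FRAMING.  Bookkeeping + composition of landed theorems; nothing of Bałaban's RG estimates is asserted, ported or discharged; the class's existence conjunct (`UkExists`) is a hypothesis of
`InRegClass` ([15] Thm 1), and ⁸'s TokE token is displayed; `PortRecordLZHalfReg` itself is NOT closed here (its `phiLZdet` summand needs `stub_P0C` + `ClassP2Reg` + the located (P5)∕NEST class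
letter); ⟨27930⟩ OPEN 1∕4 · no claim; NODE O 0∕1; COUNT 8∕28 · K 1∕4 UNMOVED; finite `𝕋⁴_{L^K}` at fixed ε — NOT continuum ∕ OS; **the Yang–Mills mass gap (Clay) is NOT proved by any of this.**
No `sorry`, no `def`, no `instance`; standard axioms only.
-/

noncomputable section

open scoped BigOperators Matrix.Norms.L2Operator Topology
open Filter

namespace Summit.QuantumFields.YangMills.Theorems.BalabanUVNodesPortS1

open Summit.QuantumFields.YangMills.Theorems.K0RecordFormatNames
open Literature.MathematicalPhysics.QuantumFieldTheory.Balaban1983to89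
open Literature.MathematicalPhysics.QuantumFieldTheory.Balaban1983to89.Node00
open Literature.MathematicalPhysics.QuantumFieldTheory.Balaban1983to89.T4Continuum (T4Family)
open Literature.MathematicalPhysics.QuantumFieldTheory.Balaban1983to89.B12TreeDecay (kappa₀)

variable (F : T4Family)

/-! ## §1  ε₀-class editions of the residue bookkeeping (add ∕ congr ∕ radii ∕ constants ∕ class radius) -/

open scoped Classical in
/-- (f′)-Reg for the sum of two families represented on the same class. [cite: Balaban1987RG1, (1.6)–(1.9) p.261, (2.12) p.268 (bookkeeping)] -/
theorem representsOnRegW_add {Mc k : ℕ} (A B : IntLocalFormula (F.L ^ (k + 1) * Mc)) (E₁w E₂w : TorusPieces F Mc k) (a₀ ε₂₉ ε₀ : ℝ)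
    (ΦA ΦB : (n : ℕ) → recordW F a₀ ε₂₉ k (recordK₀ F Mc k + n) → ℂ)
    (hA : A.Ψ.RepresentsOnRegW F a₀ ε₂₉ Mc k ε₀ E₁w ΦA) (hB : B.Ψ.RepresentsOnRegW F a₀ ε₂₉ Mc k ε₀ E₂w ΦB) :
    (A.add B).Ψ.RepresentsOnRegW F a₀ ε₂₉ Mc k ε₀ (fun n X φ => E₁w n X φ + E₂w n X φ) (fun n B => ΦA n B + ΦB n B) := by
  intro n B' hB'
  beta_reduce
  rw [hA n B' hB', hB n B' hB', ← Finset.sum_add_distrib]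
  refine Finset.sum_congr rfl fun X _ => ?_
  by_cases hX : X ∈ recordWrapCtr F Mc k (recordK₀ F Mc k + n)
  · simp only [if_pos hX]
  · simp only [if_neg hX]
    rfl

/-- ★ **`ResidueOnRegAtW` IS ADDITIVE** (same radii, same class radius; constants add). [cite: Balaban1987RG1, p.261 L22–24, (1.18) p.263, (2.12) p.268 (bookkeeping)] -/
theorem residueOnRegAtW_add {Mc k : ℕ} (A B : IntLocalFormula (F.L ^ (k + 1) * Mc)) (E₁w E₂w : TorusPieces F Mc k) (a₀ ε₂₉ α₀ α₁ ε₀ E₁ E₂ κ : ℝ)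
    (ΦA ΦB : (n : ℕ) → recordW F a₀ ε₂₉ k (recordK₀ F Mc k + n) → ℂ)
    (hA : A.ResidueOnRegAtW F Mc k E₁w a₀ ε₂₉ α₀ α₁ ε₀ E₁ κ ΦA) (hB : B.ResidueOnRegAtW F Mc k E₂w a₀ ε₂₉ α₀ α₁ ε₀ E₂ κ ΦB) :
    (A.add B).ResidueOnRegAtW F Mc k (fun n X φ => E₁w n X φ + E₂w n X φ) a₀ ε₂₉ α₀ α₁ ε₀ (E₁ + E₂) κ (fun n B => ΦA n B + ΦB n B) :=
  ⟨analyticOnUcOff_add F A B α₀ α₁ hA.1 hB.1, bound118OnUcOff_add F A B α₀ α₁ E₁ E₂ κ hA.2.1 hB.2.1,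
    analyticOnW_add F E₁w E₂w α₀ α₁ hA.2.2.1 hB.2.2.1, bound118OnW_add F E₁w E₂w α₀ α₁ E₁ E₂ κ hA.2.2.2.1 hB.2.2.2.1,
    localOnW_add F E₁w E₂w hA.2.2.2.2.1 hB.2.2.2.2.1, gaugeInvOnW_add F E₁w E₂w hA.2.2.2.2.2.1 hB.2.2.2.2.2.1,
    representsOnRegW_add F A B E₁w E₂w a₀ ε₂₉ ε₀ ΦA ΦB hA.2.2.2.2.2.2 hB.2.2.2.2.2.2⟩

/-- (f′)-Reg transfers along pointwise equality of the represented families. [cite: Balaban1987RG1, (1.6)–(1.9) p.261 (bookkeeping)] -/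
theorem representsOnRegW_congr {Mc k : ℕ} (Ψ : IntFormula) (Ew : TorusPieces F Mc k) (a₀ ε₂₉ ε₀ : ℝ)
    (Φ Φ' : (n : ℕ) → recordW F a₀ ε₂₉ k (recordK₀ F Mc k + n) → ℂ) (hΦ : ∀ n B, Φ n B = Φ' n B)
    (h : Ψ.RepresentsOnRegW F a₀ ε₂₉ Mc k ε₀ Ew Φ') : Ψ.RepresentsOnRegW F a₀ ε₂₉ Mc k ε₀ Ew Φ := by
  intro n B hB
  rw [hΦ n B, h n B hB]

variable {F} in
/-- **The ε₀-class residue is ANTITONE in the radii** (rows (a)(b) quantify over `recordUc … α₀ α₁`, which shrinks with the radii). [cite: Balaban1987RG1, p.263 L5–13, (1.18) p.263 (bookkeeping)] -/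
theorem residueOnRegAtW_anti_radii {Mc k : ℕ} {Ψ : IntLocalFormula (F.L ^ (k + 1) * Mc)} {Ew : TorusPieces F Mc k} {a₀ ε₂₉ α₀ α₀' α₁ α₁' ε₀ E₀ κ : ℝ}
    {Φf : (n : ℕ) → recordW F a₀ ε₂₉ k (recordK₀ F Mc k + n) → ℂ}
    (h : Ψ.ResidueOnRegAtW F Mc k Ew a₀ ε₂₉ α₀ α₁ ε₀ E₀ κ Φf) (h₀ : α₀' ≤ α₀) (h₁ : α₁' ≤ α₁) :
    Ψ.ResidueOnRegAtW F Mc k Ew a₀ ε₂₉ α₀' α₁' ε₀ E₀ κ Φf := by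
  obtain ⟨hA, hB, hEA, hEB, hEL, hEG, hR⟩ := h
  have sub : ∀ (n : ℕ) (X : (recordDomSys F Mc k (recordK₀ F Mc k + n)).Dom),
      recordUc F Mc k α₀' α₁' (recordK₀ F Mc k + n) X ⊆ recordUc F Mc k α₀ α₁ (recordK₀ F Mc k + n) X :=
    fun n X => recordUc_mono F Mc k (recordK₀ F Mc k + n) X h₀ h₁
  exact ⟨fun n X hX φ hφ => hA n X hX φ (sub n X hφ), fun n X hX φ hφ => hB n X hX φ (sub n X hφ),
    fun n X hX φ hφ => hEA n X hX φ (sub n X hφ), fun n X hX φ hφ => hEB n X hX φ (sub n X hφ), hEL, hEG, hR⟩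

variable {F} in
/-- **Monotonicity of the ε₀-class residue in `(E₀, κ)`.** [cite: Balaban1987RG1, (1.18) p.263 (bookkeeping)] -/
theorem residueOnRegAtW_mono {Mc k : ℕ} {Ψ : IntLocalFormula (F.L ^ (k + 1) * Mc)} {Ew : TorusPieces F Mc k} {a₀ ε₂₉ α₀ α₁ ε₀ E₀ E₀' κ κ' : ℝ}
    {Φf : (n : ℕ) → recordW F a₀ ε₂₉ k (recordK₀ F Mc k + n) → ℂ}
    (h : Ψ.ResidueOnRegAtW F Mc k Ew a₀ ε₂₉ α₀ α₁ ε₀ E₀ κ Φf) (hE : E₀ ≤ E₀') (hκ : κ' ≤ κ) (hE₀' : 0 ≤ E₀') :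
    Ψ.ResidueOnRegAtW F Mc k Ew a₀ ε₂₉ α₀ α₁ ε₀ E₀' κ' Φf := by
  have key : ∀ (n : ℕ) (X : (recordDomSys F Mc k (recordK₀ F Mc k + n)).Dom) (t : ℝ),
      t ≤ E₀ * Real.exp (-κ * (recordDomSys F Mc k (recordK₀ F Mc k + n)).dj X) →
        t ≤ E₀' * Real.exp (-κ' * (recordDomSys F Mc k (recordK₀ F Mc k + n)).dj X) := by
    intro n X t ht
    have hd : 0 ≤ (recordDomSys F Mc k (recordK₀ F Mc k + n)).dj X := (recordDomSys F Mc k (recordK₀ F Mc k + n)).dj_nonneg X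
    have hexp : Real.exp (-κ * (recordDomSys F Mc k (recordK₀ F Mc k + n)).dj X) ≤ Real.exp (-κ' * (recordDomSys F Mc k (recordK₀ F Mc k + n)).dj X) :=
      Real.exp_le_exp.mpr (mul_le_mul_of_nonneg_right (neg_le_neg hκ) hd)
    exact ht.trans ((mul_le_mul_of_nonneg_right hE (Real.exp_pos _).le).trans (mul_le_mul_of_nonneg_left hexp hE₀'))
  obtain ⟨hA, hB, hEA, hEB, hEL, hEG, hR⟩ := h
  exact ⟨hA, fun n X hX φ hφ => key n X _ (hB n X hX φ hφ), hEA, fun n X hX φ hφ => key n X _ (hEB n X hX φ hφ), hEL, hEG, hR⟩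

variable {F} in
/-- **A smaller class radius keeps the residue** (`InRegClass` grows with `ε₀`). [cite: Balaban1987RG1, (1.1)–(1.2) p.260 (bookkeeping)] -/
theorem residueOnRegAtW_anti_eps {Mc k : ℕ} {Ψ : IntLocalFormula (F.L ^ (k + 1) * Mc)} {Ew : TorusPieces F Mc k} {a₀ ε₂₉ α₀ α₁ ε₀ ε₀' E₀ κ : ℝ}
    {Φf : (n : ℕ) → recordW F a₀ ε₂₉ k (recordK₀ F Mc k + n) → ℂ}
    (h : Ψ.ResidueOnRegAtW F Mc k Ew a₀ ε₂₉ α₀ α₁ ε₀ E₀ κ Φf) (hε : ε₀' ≤ ε₀) :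
    Ψ.ResidueOnRegAtW F Mc k Ew a₀ ε₂₉ α₀ α₁ ε₀' E₀ κ Φf := by
  obtain ⟨hA, hB, hEA, hEB, hEL, hEG, hR⟩ := h
  exact ⟨hA, hB, hEA, hEB, hEL, hEG, fun n B hB' => hR n B (inRegClass_mono hε hB')⟩

/-! ## §2  ★★★ (f′)-Reg for the δ-Jacobian bracket -/

open scoped Classical in
/-- ★★★ **(f′)-Reg FOR THE δ-JACOBIAN BRACKET**: under ⁸'s TokE token shape at one radius `ε₁` (all member volumes) and for the class radius `ε₀ ≤ 1∕(53581824·L⁶)`, `2ε₀ ≤ ε₁`, the integer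
formula `ΨjacRaw F Mc k` and the torus pieces `jacTorusPieces F Mc k` REPRESENT `phiLZjac` AT EVERY POINT OF THE ε₀-CLASS:
`phiLZjac n B = Σ_X (X ∈ wrap ? E_T(X, pair cut to X) : Ψ_jac(X̂)(pulled-back pair cut to X))` (✓`jacFactor_eq_jacTorus_of_inRegClass` at `B` and at the base point `0 ∈` class, the fibre
decomposition `Σ_c = Σ_X Σ_{X(c) = X}`, locality of `E_T`, the off-wrap identification). [cite: Balaban1987RG1, (1.6)–(1.9) p.261, (1.21) p.264, (1.1)–(1.2) p.260, p.268] -/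
theorem representsOnRegW_phiLZjac {Mc : ℕ} (hMc : McGuard F Mc) (a₀ ε₂₉ : ℝ) (k : ℕ) (ha₀ : 0 < a₀) {ε₀ ε₁ : ℝ} (hε₀ : 0 < ε₀)
    (hc : ε₀ ≤ 1 / (53581824 * (F.L : ℝ) ^ 6)) (hε₁ : 2 * ε₀ ≤ ε₁)
    (hTokE : ∀ (n : ℕ) (V : GaugeField (F.P (recordK₀ F Mc k + n)) (k + 1) (SU 2)), PlaqSmall ε₁ V →
      UkExists F 2 (recordK₀ F Mc k + n) (k + 1) a₀ V ∧ UniqueUkOrbit F 2 (recordK₀ F Mc k + n) (k + 1) a₀ V) :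
    (ΨjacRaw F Mc k).RepresentsOnRegW F a₀ ε₂₉ Mc k ε₀ (jacTorusPieces F Mc k) (phiLZjac F Mc a₀ ε₂₉ k) := by
  intro n B hB
  letI θ := thetaFill F a₀ ε₂₉; letI := θ.instVβ₁; letI := θ.instVβ₂; letI := θ.instιβ
  have hk := succ_le_m_add_K_recordK₀ F Mc k n
  have hK : recordK₀ F Mc k ≤ recordK₀ F Mc k + n := Nat.le_add_right _ n
  have hcl := jacFactor_eq_jacTorus_of_inRegClass F a₀ ε₂₉ Mc k n hε₀ hc hε₁ (hTokE n) hB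
  have h0 : ∀ c : PBond (F.P (recordK₀ F Mc k + n)) (k + 1), ((jacFactor F a₀ ε₂₉ k (recordK₀ F Mc k + n) 0 c : ℝ) : ℂ) = jacTorus k c 1 := by
    intro c
    have h := jacFactor_eq_jacTorus_of_inRegClass F a₀ ε₂₉ Mc k n hε₀ hc hε₁ (hTokE n) (inRegClass_zero F Mc k n ε₂₉ hε₀ ha₀) c
    rw [recordBgField_zero F θ hk] at h
    rw [h]; rfl
  -- the pair of `U_{k+1}(W_B)` on the torus
  set φB : Sect2.CPair (F.P (recordK₀ F Mc k + n)) (MatA 2) :=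
    (coeField (recordBgField F θ k (recordK₀ F Mc k + n) B), recordCurrent F θ k (recordK₀ F Mc k + n) B) with hφB
  -- Step 1: `phiLZjac n B = −Σ_c (J_T(c, ↑U_B) − J_T(c, 1)) = Σ_X E_T(X, φ_B)`
  have hsum : phiLZjac F Mc a₀ ε₂₉ k n B = ∑ X : (recordDomSys F Mc k (recordK₀ F Mc k + n)).Dom, jacPieceT F Mc k (recordK₀ F Mc k + n) X φB := by
    have e1 : phiLZjac F Mc a₀ ε₂₉ k n B = -∑ c : PBond (F.P (recordK₀ F Mc k + n)) (k + 1), (jacTorus k c φB.1 - jacTorus k c 1) := by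
      unfold phiLZjac
      push_cast
      congr 1
      refine Finset.sum_congr rfl fun c _ => ?_
      rw [hcl c, h0 c]
    rw [e1, ← Finset.sum_fiberwise Finset.univ (fun c : PBond (F.P (recordK₀ F Mc k + n)) (k + 1) => domOfBond F Mc k (recordK₀ F Mc k + n) c)
      (fun c => jacTorus k c φB.1 - jacTorus k c 1), ← Finset.sum_neg_distrib]
    rfl
  rw [hsum]
  refine Finset.sum_congr rfl fun X _ => ?_
  -- Step 2: cut to `X` (locality), then read off/on the wrap class
  have hcut : jacPieceT F Mc k (recordK₀ F Mc k + n) X φB = jacPieceT F Mc k (recordK₀ F Mc k + n) X (pairCutTorusAt F a₀ ε₂₉ Mc k (recordK₀ F Mc k + n) X B) :=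
    jacPieceT_congr_of_agreeOnSet hMc hK X (agreeOnSet_pairCutTorusAt a₀ ε₂₉ Mc k _ X B)
  rw [hcut]
  split_ifs with hX
  · rfl
  · rw [pairCutAt_eq_pullPair_pairCutTorusAt, ΨjacRaw_intCubes_pullPair hMc hK hX]

/-! ## §3  ★★★ The δ-Jacobian half of `log Z^{(k)}` in Thm 3's format ON THE CLASS, unconditionally -/

/-- ★★★ **THE δ-JACOBIAN HALF ON THE ε₀-CLASS, UNCONDITIONAL**: for every torus family, at every admissible `Mc ≥ Mth` (`Mth` of ✓`JacRowsAB`, itself a THEOREM by ✓`stub_LZjacDom` +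
✓`stub_LZjacKStep`), given `2L² ≤ B₃`, `0 < a₀`, `0 < a₁` and ⁸'s TokE token (existence + uniqueness of the minimal orbit over plaquette-small level-`(k+1)` data), for EVERY `ε₂₉` there are
k-UNIFORM constants `E₁ = 8Mc⁴·E·e^κ ≥ 0`, `κ = max (4κ₀(64,8)) 0`, radii `α₀ α₁ > 0` and the CLASS RADIUS `δ₀ = min (ε₁∕2) (1∕(53581824·L⁶)) > 0` (`ε₁ = min a₁ (a₀∕B₃)`) such that at every
level `k` the integer formula `Ψ_jac` and the torus pieces `E_T` satisfy `ResidueOnRegAtW … δ₀ E₁ κ (phiLZjac …)` — rows (a)–(e) AND the (f′) identity AT EVERY POINT of `InRegClass … δ₀`.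
[cite: Balaban1987RG1, (1.6)–(1.7) p.261, (1.18)–(1.19) p.263, (1.21) p.264, (1.1)–(1.2) p.260, p.268; Balaban1985Variational, Thm 1 p.279] -/
theorem lzjacResidueOnReg : ∃ Mth : ℕ, ∀ Mc : ℕ, Mth ≤ Mc → McGuard F Mc →
    ∀ (B₃ a₀ a₁ : ℝ), 2 * (F.L : ℝ) ^ 2 ≤ B₃ → 0 < a₀ → 0 < a₁ →
    (∀ ε₁ : ℝ, 0 < ε₁ → ε₁ ≤ a₁ → B₃ * ε₁ ≤ a₀ → ∀ (k n : ℕ) (V : GaugeField (F.P (recordK₀ F Mc k + n)) (k + 1) (SU 2)), PlaqSmall ε₁ V →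
      UkExists F 2 (recordK₀ F Mc k + n) (k + 1) a₀ V ∧ UniqueUkOrbit F 2 (recordK₀ F Mc k + n) (k + 1) a₀ V) →
    ∀ ε₂₉ : ℝ, ∃ E₁ κ α₀ α₁ δ₀ : ℝ, 0 ≤ E₁ ∧ 4 * kappa₀ (4 * 2 ^ 4) (2 * 4) ≤ κ ∧ 0 < α₀ ∧ 0 < α₁ ∧ 0 < δ₀ ∧
      ∀ k : ℕ, ∃ (Ψ : IntLocalFormula (F.L ^ (k + 1) * Mc)) (Ew : TorusPieces F Mc k),
        Ψ.ResidueOnRegAtW F Mc k Ew a₀ ε₂₉ α₀ α₁ δ₀ E₁ κ (phiLZjac F Mc a₀ ε₂₉ k) := by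
  obtain ⟨Mth, hrows⟩ := jacRowsAB_all_of_kstep_of_dom stub_LZjacKStep stub_LZjacDom F
  refine ⟨Mth, fun Mc hMth hMcG B₃ a₀ a₁ hB₃ ha₀ ha₁ hTokE ε₂₉ => ?_⟩
  obtain ⟨α₀, α₁, E, hα₀, hα₁, hE, hAB⟩ := hrows Mc hMth hMcG
  have hMc0 : 0 < Mc := by obtain ⟨c', rfl⟩ := hMcG; exact pow_pos (by have := F.hL.2; omega) _
  have hLpos : (0 : ℝ) < F.L := by
    have hL1 : 0 < F.L := by have := F.hL.2; omega
    exact_mod_cast hL1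
  have hL2 : (0 : ℝ) < 2 * (F.L : ℝ) ^ 2 := by positivity
  have hB₃pos : 0 < B₃ := lt_of_lt_of_le hL2 hB₃
  -- the TokE shape at one admissible `ε₁`
  set ε₁ : ℝ := min a₁ (a₀ / B₃) with hε₁def
  have hε₁ : 0 < ε₁ := lt_min ha₁ (div_pos ha₀ hB₃pos)
  have hε₁a₁ : ε₁ ≤ a₁ := min_le_left _ _
  have hε₁a₀ : B₃ * ε₁ ≤ a₀ := by
    calc B₃ * ε₁ ≤ B₃ * (a₀ / B₃) := by gcongr; exact min_le_right _ _
      _ = a₀ := by field_simp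
  have hTokE' : ∀ (k n : ℕ) (V : GaugeField (F.P (recordK₀ F Mc k + n)) (k + 1) (SU 2)), PlaqSmall ε₁ V →
      UkExists F 2 (recordK₀ F Mc k + n) (k + 1) a₀ V ∧ UniqueUkOrbit F 2 (recordK₀ F Mc k + n) (k + 1) a₀ V :=
    fun k n V hV => hTokE ε₁ hε₁ hε₁a₁ hε₁a₀ k n V hV
  -- the class radius
  set δ₀ : ℝ := min (ε₁ / 2) (1 / (53581824 * (F.L : ℝ) ^ 6)) with hδ₀def
  have hδ₀ : 0 < δ₀ := lt_min (half_pos hε₁) (by positivity)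
  have hδ₀c : δ₀ ≤ 1 / (53581824 * (F.L : ℝ) ^ 6) := min_le_right _ _
  have hδ₀ε : 2 * δ₀ ≤ ε₁ := by have := min_le_left (ε₁ / 2) (1 / (53581824 * (F.L : ℝ) ^ 6)); linarith
  -- the constants
  set κ : ℝ := max (4 * kappa₀ (4 * 2 ^ 4) (2 * 4)) 0 with hκdef
  have hκ : 0 ≤ κ := le_max_right _ _
  refine ⟨8 * (Mc : ℝ) ^ 4 * E * Real.exp κ, κ, α₀, α₁, δ₀, by positivity, le_max_left _ _, hα₀, hα₁, hδ₀, fun k => ?_⟩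
  refine ⟨⟨ΨjacRaw F Mc k, isLocal_ΨjacRaw F hMc0 k, isGaugeInv_ΨjacRaw F Mc k⟩, jacTorusPieces F Mc k, ?_⟩
  exact ⟨analyticOnUcOff_ΨjacRaw F hMcG k (fun n c φ hφ => (hAB k n c φ hφ).1),
    bound118OnUcOff_ΨjacRaw F hMcG k hE hκ (fun n c φ hφ => (hAB k n c φ hφ).2),
    analyticOnW_jacTorusPieces F (fun n c φ hφ => (hAB k n c φ hφ).1),
    bound118OnW_jacTorusPieces F hMcG hE hκ (fun n c φ hφ => (hAB k n c φ hφ).2),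
    localOnW_jacTorusPieces F hMcG k, gaugeInvOnW_jacTorusPieces F Mc k,
    representsOnRegW_phiLZjac F hMcG a₀ ε₂₉ k ha₀ hδ₀ hδ₀c hδ₀ε (hTokE' k)⟩

end Summit.QuantumFields.YangMills.Theorems.BalabanUVNodesPortS1

end
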